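import Summits.QuantumFields.YangMills.Theorems.BalabanUVNodesK0PrintCubeOfStepTokensGuarded
import Literature.MathematicalPhysics.QuantumFieldTheory.Balaban1983to89.Node00.Record13NumericsOfThm1CCMZ

/-!
# K0⁷ — THE K0 BODY AT THE NAMED z-WITNESS `θ₁₅ᶜᶜᴹᵂᶻ(j; γ; …; Efl, logz)` (FLAG №9's Z edition, DEF-1 Z1∕Z2) FROM THE V20-G STUB ANTECEDENTS — FOR EVERY PAIR OF
# FLUCTUATION LETTERS `(Efl, logz)`: row P11, `Provisos₁₃SepCoP`, the ⁵ conjuncts, and the NAMED cured ∕ history-blind ⁷ parameter, by DEFINITIONAL TRANSPORT from `θ₁₅ᶜᶜᴹᵂ`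

Cell `pub-ymgap`, seat `pub-ymgap-k0-s1-w3` generation 7 (K0⁷ `stmt-QuantumFields-20541`, V20-G stub 1 `stub_prop8StepCoPG13` helper lane;
`--kind proof --supports stmt-QuantumFields-20541 --as helper`).  NEW leaf over this seat's `…K0AllTorusOfStepTokensGuarded` (p635083) ∕ `…K0PrintCubeOfStepTokensGuarded` (p635645) and
ym-nodeO DEF-1's Z2 `Node00/Record13NumericsOfThm1CCMZ` (p639492; Z1 p637981).  Theorems only (0 `def`, 0 `sorry`); nothing in the tree is modified.  Plan g86 ANSWER-218 (i):
«K0⁷ side — the compositions generalise to θZ by token-pass … this is what gives ONE θ serving K0's hypothesis AND K1's conclusion».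

THE FINDING (kernel, `rfl`).  At the z-witness `θ₁₅ᶜᶜᴹᵂᶻ(j; γ; ε₀, ε₂₉; B₃, B₃′, a₀, a₁; Efl, logz)` (Z2 `theta13OfThm1CCMWZ`; the landed `θ₁₅ᶜᶜᴹᵂ` is its `(0, 0)` instance by `rfl`) EVERY
object the (7)-guarded separated row P11 reads is LETTER-BLIND DEFINITIONALLY: `betaOfRecord₁₃`, hence `gOfRecord₁₃` (the run's couplings) and the window, `settingOfRecord₁₃` (laws ∕
flow ∕ Hölder constants), `lfOfRecord₁₂`, `PartCompat₁₃`, `suppOfRecord₁₃P`, `UbgOfRecord₁₃CoP` — the structure updates of Z1 touch the fields `Efl`, `logz` only, which none of these read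
([III] (1.15): `E_k`, `log z_k` normalise the densities, not the backgrounds).  Hence §1: this seat's row-P11-at-the-witness theorem (guard currency, `…K0AllTorusOfStepTokensGuarded` §2)
PROVES the same sentence at `θ₁₅ᶜᶜᴹᵂᶻ(…; Efl, logz)` for every `(Efl, logz)` — the proof term is the landed one, accepted by the kernel at the new type (definitional unfolding, no
rewriting).  §2 then NAMES the parameter: `Provisos₁₃SepCoP` at the z-witness (K0a's θ-generic `provisos₁₃SepCoP_liveRepin₁₃_of_bgSepCoP` at Z2's `theta13OfNumericsZ`, rows Z ∕ P12 ∕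
G from Z2), the ⁵ conjuncts, and the cured (node00-def-R `Stage13RParams.ofCured`) and history-blind (def-T `Stage13HParams.ofHistoryBlind`) lifts — a NAMED `θ : Stage13HParams F 2` with
`θ.Efl = Efl`, `θ.logz = logz` carrying K0⁷'s four conjuncts.  §3 feeds it from the V20-G stub antecedents at a cube letter `(j, c, c₀)` and from the three stub texts (the abs β-box is
letter-blind too: `betaOfRecord₁₃ θZ = betaOfRecord₁₃ θ` by `rfl`, so V20-G's 3ᴬ′ at `θ₁₅ᶜᶜᴹ(j)` serves every z-member).  What a K1⁹ prover gets: for ITS choice of `(Efl, logz)` (N13's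
delivered pair), the K0 hypothesis' parameter and the K1 conclusion's parameter can be THE SAME named θ.

HONEST FRAMING: count-neutral kernel bookkeeping (definitional transport + compositions BY NAME); every [15]∕[6]∕[I] sentence is a HYPOTHESIS inhabited nowhere; no value of `E_k` ∕
`log z_k` is pinned (OPEN LETTERS); nothing of Bałaban asserted; FLAG №9 NOT closed by this (№218 (4): N13's pair is REAL WORK); `stub_prop8StepCoPG13` ∕ K0⁷ ∕ K1⁹ NOT closed; N07
NOT discharged; counts unmoved (typed 28∕28 · discharged 5∕27); the route closes only the conditional finite-𝕋⁴ rung `BalabanLadder.UV` — the YM mass gap (Clay) is NOT proved by any of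
this; nothing continuum ∕ ℝ⁴ ∕ OS.  No `sorry`, `def`, `instance`, `notation`.
[15] = Bałaban, CMP 102 (1985) 277–309 [Balaban1985Variational]; [III] = CMP 119 (1988) 243 [Balaban1988Convergent]; [I] = CMP 109 (1987) 249 [Balaban1987RG1];
[IV] = CMP 122 (1989) 175 [Balaban1989LargeFieldI]; [V] = [Balaban1989LargeFieldII].
-/

noncomputable section

open MeasureTheory
open scoped Matrix.Norms.L2Operator

namespace Summit.QuantumFields.YangMills.Theorems.K0NamedZWitnessOfStepTokensGuarded

open Literature.MathematicalPhysics.QuantumFieldTheory.Balaban1983to89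
open Literature.MathematicalPhysics.QuantumFieldTheory.Balaban1983to89.Node00
open Literature.MathematicalPhysics.QuantumFieldTheory.Balaban1983to89.T4Continuum
open Literature.MathematicalPhysics.QuantumFieldTheory.Balaban1983to89.FlowStep
open Literature.MathematicalPhysics.QuantumFieldTheory.Balaban1983to89.FlowStepRuns
open Literature.MathematicalPhysics.QuantumFieldTheory.Balaban1983to89.B14.Eq218Concrete
open Literature.MathematicalPhysics.QuantumFieldTheory.Balaban1983to89.B15DeterminingSets
open Literature.MathematicalPhysics.QuantumFieldTheory.Balaban1983to89.B12RegularSpaces111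
open Literature.MathematicalPhysics.QuantumFieldTheory.Balaban1983to89.B14RegularSpaces234
open Literature.MathematicalPhysics.QuantumFieldTheory.Balaban1983to89.B8LeafModelZd (ZdIdx)
open Summit.QuantumFields.YangMills.BalabanUVNodes.N07Thm1Top7FromProp8 (variationalThm1RegSepCoP7MG_of_prop8TopStepG)
open Summit.QuantumFields.YangMills.Theorems.K0GenericCubeOfStepTokensR (clausesH_of_absBox)
open Summit.QuantumFields.YangMills.Theorems.K0AllTorusOfStepTokensGuarded (bgSepCoPAt_theta13OfThm1CCMW_of_thm1RegSepCoP7MG_of_thm1GaugeG_of_hcomp_allTorus)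
open Summit.QuantumFields.YangMills.Theorems.K0PrintCubeOfStepTokensGuarded (gauge9SupplierG_of_prop6MemberP)

/-! ## §0  The letter-blind faces of the z-witness the row reads (kernel `rfl`; displayed so that reviewers see WHY §1's transport is definitional) -/

section Faces

variable (F : T4Family) (N : ℕ) [NeZero N] (j : ℕ) (γ ε₀ ε₂₉ B₃ B₃' a₀ a₁ : ℝ) (Efl logz : B12.RunParams → ℕ → ℝ)

-- NOTE: the β-face `betaOfRecord₁₃ F N (θ₁₅ᶜᶜᴹᵂᶻ …) = betaOfRecord₁₃ F N θ₁₅ᶜᶜᴹᵂ` (`rfl`) is ALREADY LANDED as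
-- `Summit.QuantumFields.YangMills.Theorems.K0Stub3ZWitnessBlind.betaOfRecord₁₃_theta13OfThm1CCMWZ` (k0-s3 lane, 2026-08-28) — cited, not restated.

/-- The run's couplings are letter-blind (`rfl`). [cite: Balaban1987RG1, (0.17)–(0.20) pp.255–256 (bookkeeping)] -/
theorem gOfRecord₁₃_theta13OfThm1CCMWZ (p : B12.RunParams) :
    gOfRecord₁₃ F N (theta13OfThm1CCMWZ F N j γ ε₀ ε₂₉ B₃ B₃' a₀ a₁ Efl logz) p = gOfRecord₁₃ F N (theta13OfThm1CCMW F N j γ ε₀ ε₂₉ B₃ B₃' a₀ a₁) p := rfl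

/-- The small-field setting of record along a run is letter-blind (`rfl`). [cite: Balaban1988Convergent, (2.4)–(2.8) pp.255–256 (bookkeeping)] -/
theorem settingOfRecord₁₃_theta13OfThm1CCMWZ (p : B12.RunParams) :
    settingOfRecord₁₃ F N (theta13OfThm1CCMWZ F N j γ ε₀ ε₂₉ B₃ B₃' a₀ a₁ Efl logz) p = settingOfRecord₁₃ F N (theta13OfThm1CCMW F N j γ ε₀ ε₂₉ B₃ B₃' a₀ a₁) p := rfl

/-- The Co-carrier background of record is letter-blind (`rfl`). [cite: Balaban1988Convergent, (2.12) p.256 (bookkeeping)] -/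
theorem UbgOfRecord₁₃CoP_theta13OfThm1CCMWZ (p : B12.RunParams) :
    UbgOfRecord₁₃CoP F N (theta13OfThm1CCMWZ F N j γ ε₀ ε₂₉ B₃ B₃' a₀ a₁ Efl logz) p = UbgOfRecord₁₃CoP F N (theta13OfThm1CCMW F N j γ ε₀ ε₂₉ B₃ B₃' a₀ a₁) p := rfl

/-- The (7)-guarded separated support is letter-blind (`rfl`). [cite: Balaban1988Convergent, (2.10) p.256 (bookkeeping)] -/
theorem suppOfRecord₁₃P_theta13OfThm1CCMWZ (p : B12.RunParams) (n : ℕ) :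
    suppOfRecord₁₃P F N (theta13OfThm1CCMWZ F N j γ ε₀ ε₂₉ B₃ B₃' a₀ a₁ Efl logz) p n = suppOfRecord₁₃P F N (theta13OfThm1CCMW F N j γ ε₀ ε₂₉ B₃ B₃' a₀ a₁) p n := rfl

/-- The letters themselves ARE read back (`rfl`, Z2): `θ₁₅ᶜᶜᴹᵂᶻ(…; Efl, logz).Efl = Efl`, and at the cured ∕ history-blind lifts. [cite: Balaban1988Convergent, (1.15) p.249 (bookkeeping)] -/
theorem ofHistoryBlind_ofCured_theta13OfThm1CCMWZ_Efl :
    (Stage13HParams.ofHistoryBlind F N (Stage13RParams.ofCured F N (theta13OfThm1CCMWZ F N j γ ε₀ ε₂₉ B₃ B₃' a₀ a₁ Efl logz))).Efl = Efl := rfl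

/-- `… .logz = logz` at the lifts (`rfl`). [cite: Balaban1989LargeFieldII, (0.15) p.360 (bookkeeping)] -/
theorem ofHistoryBlind_ofCured_theta13OfThm1CCMWZ_logz :
    (Stage13HParams.ofHistoryBlind F N (Stage13RParams.ofCured F N (theta13OfThm1CCMWZ F N j γ ε₀ ε₂₉ B₃ B₃' a₀ a₁ Efl logz))).logz = logz := rfl

end Faces

/-! ## §1  ★ Row P11 at the z-witness under the concrete two-letter guard — the landed θ₁₅ᶜᶜᴹᵂ theorem AT THE NEW TYPE (definitional transport) -/

section RowZ

variable {F : T4Family} {N : ℕ} [NeZero N] {j c c₀ : ℕ} {γ ε₀ ε₂₉ B₃ B₃' a₀ a₁ : ℝ} {Efl logz : B12.RunParams → ℕ → ℝ}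

/-- **★ THE (7)-GUARDED SEPARATED ROW P11 AT THE Co CARRIER AT THE z-WITNESS `θ₁₅ᶜᶜᴹᵂᶻ(j; γ; …; Efl, logz)`, FOR EVERY `(Efl, logz)`**, from `0 < γ ≤ ½`, the guarded (8)∕gauge sentences at
the concrete guard (`c ≤ L^j`, `c₀ ≤ j + 1`) and (hcomp) ∧ (hcompRev) — `K0AllTorusOfStepTokensGuarded.bgSepCoPAt_theta13OfThm1CCMW_…` accepted by the kernel at the z-witness's type
(§0: every object read is letter-blind by `rfl`).  CONDITIONAL; nothing of Bałaban asserted. [cite: Balaban1985Variational, (6)–(7) p.278, Thm 1 (8)–(9) p.279, Prop. 8 p.304, p.304 lines 1–2; Balaban1988Convergent, Thm 1 p.262, (1.15) p.249, (2.12)–(2.13) pp.256–257, (2.28) p.259; Balaban1989LargeFieldI, (0.3) p.176; Balaban1987RG1, (0.1) p.251] -/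
theorem bgSepCoPAt_theta13OfThm1CCMWZ_of_thm1RegSepCoP7MG_of_thm1GaugeG_of_hcomp_allTorus (hγ0 : 0 < γ) (hγ : γ ≤ 1 / 2) (hε : 0 < ε₀) (hε' : 0 < ε₂₉) (hB : 0 ≤ B₃) (hB' : 0 ≤ B₃')
    (ha₀ : 0 < a₀) (ha₁ : 0 < a₁) (hc : c ≤ F.L ^ j) (hc₀ : c₀ ≤ j + 1)
    (h15 : VariationalThm1RegSepCoP7MG F N (fun ν _M _g K k _s => c ≤ ν.M₁ ∧ k + c₀ ≤ F.m + K) B₃ a₀ a₁)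
    (h15G : VariationalThm1GaugeRegSepCoP7MG F N (F.L ^ j) (fun ν _M _g K k _s => c ≤ ν.M₁ ∧ k + c₀ ≤ F.m + K) B₃ B₃' a₀ a₁)
    (hcomp : ∀ (p : B12.RunParams) (n : ℕ), n ≤ p.K → Step.InInterval (theta13OfThm1CCMWZ F N j γ ε₀ ε₂₉ B₃ B₃' a₀ a₁ Efl logz).γ n (gOfRecord₁₃ F N (theta13OfThm1CCMWZ F N j γ ε₀ ε₂₉ B₃ B₃' a₀ a₁ Efl logz) p) → ∀ m, m < n →
      (theta13OfThm1CCMWZ F N j γ ε₀ ε₂₉ B₃ B₃' a₀ a₁ Efl logz).s2.cR * epsOfRecord (theta13OfThm1CCMWZ F N j γ ε₀ ε₂₉ B₃ B₃' a₀ a₁ Efl logz).ν (gOfRecord₁₃ F N (theta13OfThm1CCMWZ F N j γ ε₀ ε₂₉ B₃ B₃' a₀ a₁ Efl logz) p) m ≤ 2 * ((theta13OfThm1CCMWZ F N j γ ε₀ ε₂₉ B₃ B₃' a₀ a₁ Efl logz).s2.cR * epsOfRecord (theta13OfThm1CCMWZ F N j γ ε₀ ε₂₉ B₃ B₃' a₀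 a₁ Efl logz).ν (gOfRecord₁₃ F N (theta13OfThm1CCMWZ F N j γ ε₀ ε₂₉ B₃ B₃' a₀ a₁ Efl logz) p) (m + 1)))
    (hcompRev : ∀ (p : B12.RunParams) (n : ℕ), n ≤ p.K → Step.InInterval (theta13OfThm1CCMWZ F N j γ ε₀ ε₂₉ B₃ B₃' a₀ a₁ Efl logz).γ n (gOfRecord₁₃ F N (theta13OfThm1CCMWZ F N j γ ε₀ ε₂₉ B₃ B₃' a₀ a₁ Efl logz) p) → ∀ m, m < n →
      (theta13OfThm1CCMWZ F N j γ ε₀ ε₂₉ B₃ B₃' a₀ a₁ Efl logz).s2.cR * epsOfRecord (theta13OfThm1CCMWZ F N j γ ε₀ ε₂₉ B₃ B₃' a₀ a₁ Efl logz).ν (gOfRecord₁₃ F N (theta13OfThm1CCMWZ F N j γ ε₀ ε₂₉ B₃ B₃' a₀ a₁ Efl logz) p) (m + 1) ≤ 2 * ((theta13OfThm1CCMWZ F N j γ ε₀ ε₂₉ B₃ B₃' a₀ a₁ Efl logz).s2.cR * epsOfRecord (theta13OfThm1CCMWZ F N j γ ε₀ ε₂₉ B₃ B₃' a₀ a₁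 Efl logz).ν (gOfRecord₁₃ F N (theta13OfThm1CCMWZ F N j γ ε₀ ε₂₉ B₃ B₃' a₀ a₁ Efl logz) p) m)) :
    ∀ (p : B12.RunParams) (n : ℕ), n ≤ p.K → Step.InInterval (theta13OfThm1CCMWZ F N j γ ε₀ ε₂₉ B₃ B₃' a₀ a₁ Efl logz).γ n (gOfRecord₁₃ F N (theta13OfThm1CCMWZ F N j γ ε₀ ε₂₉ B₃ B₃' a₀ a₁ Efl logz) p) → PartCompat₁₃ F N (theta13OfThm1CCMWZ F N j γ ε₀ ε₂₉ B₃ B₃' a₀ a₁ Efl logz) p n →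
      ∀ s : SeqOfRecord F (theta13OfThm1CCMWZ F N j γ ε₀ ε₂₉ B₃ B₃' a₀ a₁ Efl logz).ν (theta13OfThm1CCMWZ F N j γ ε₀ ε₂₉ B₃ B₃' a₀ a₁ Efl logz).τ9.M (gOfRecord₁₃ F N (theta13OfThm1CCMWZ F N j γ ε₀ ε₂₉ B₃ B₃' a₀ a₁ Efl logz) p) p.K n, Sect2.SeqSeparated (theta13OfThm1CCMWZ F N j γ ε₀ ε₂₉ B₃ B₃' a₀ a₁ Efl logz).ν.M₁ s →
      ∀ W : MSField (F.P p.K) (SU N), W ∈ suppOfRecord₁₃P F N (theta13OfThm1CCMWZ F N j γ ε₀ ε₂₉ B₃ B₃' a₀ a₁ Efl logz) p n s →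
      Sect2.DataSmall7PTop (avOfRecord F N p.K) s.Ω (suppDomOfRecord F (theta13OfThm1CCMWZ F N j γ ε₀ ε₂₉ B₃ B₃' a₀ a₁ Efl logz).ν p.K s.Ω) n (fun j' => (theta13OfThm1CCMWZ F N j γ ε₀ ε₂₉ B₃ B₃' a₀ a₁ Efl logz).s2.cR * epsOfRecord (theta13OfThm1CCMWZ F N j γ ε₀ ε₂₉ B₃ B₃' a₀ a₁ Efl logz).ν (gOfRecord₁₃ F N (theta13OfThm1CCMWZ F N j γ ε₀ ε₂₉ B₃ B₃' a₀ a₁ Efl logz) p) j') W →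
      ∀ j', 1 ≤ j' → j' ≤ n → ∀ X : (Sect2.domSys (F.P p.K) (theta13OfThm1CCMWZ F N j γ ε₀ ε₂₉ B₃ B₃' a₀ a₁ Efl logz).τ9.M j').Dom,
      (Sect2.domSites (F.P p.K) (theta13OfThm1CCMWZ F N j γ ε₀ ε₂₉ B₃ B₃' a₀ a₁ Efl logz).τ9.M j' X ⊆ s.Λ j' →
        Sect2.ofBackgroundC (settingOfRecord₁₃ F N (theta13OfThm1CCMWZ F N j γ ε₀ ε₂₉ B₃ B₃' a₀ a₁ Efl logz) p).ι (UbgOfRecord₁₃CoP F N (theta13OfThm1CCMWZ F N j γ ε₀ ε₂₉ B₃ B₃' a₀ a₁ Efl logz) p n s W) ∈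
          Sect2.spaceI (settingOfRecord₁₃ F N (theta13OfThm1CCMWZ F N j γ ε₀ ε₂₉ B₃ B₃' a₀ a₁ Efl logz) p) ((theta13OfThm1CCMWZ F N j γ ε₀ ε₂₉ B₃ B₃' a₀ a₁ Efl logz).Rz p.K) (theta13OfThm1CCMWZ F N j γ ε₀ ε₂₉ B₃ B₃' a₀ a₁ Efl logz).τ9.M j' (Sect2.domSites (F.P p.K) (theta13OfThm1CCMWZ F N j γ ε₀ ε₂₉ B₃ B₃' a₀ a₁ Efl logz).τ9.M j' X)
            ((settingOfRecord₁₃ F N (theta13OfThm1CCMWZ F N j γ ε₀ ε₂₉ B₃ B₃' a₀ a₁ Efl logz) p).lf.alpha0 ((settingOfRecord₁₃ F N (theta13OfThm1CCMWZ F N j γ ε₀ ε₂₉ B₃ B₃' a₀ a₁ Efl logz) p).flow.g j')) ((settingOfRecord₁₃ F N (theta13OfThm1CCMWZ F N j γ ε₀ ε₂₉ B₃ B₃' a₀ a₁ Efl logz) p).lf.alpha1 ((settingOfRecord₁₃ F N (theta13OfThm1CCMWZ F N j γ ε₀ ε₂₉ B₃ B₃' a₀ a₁ Efl logz) p).flow.g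 j'))) ∧
      (Sect2.admB (F.P p.K) (theta13OfThm1CCMWZ F N j γ ε₀ ε₂₉ B₃ B₃' a₀ a₁ Efl logz).ν (theta13OfThm1CCMWZ F N j γ ε₀ ε₂₉ B₃ B₃' a₀ a₁ Efl logz).τ9.M (gOfRecord₁₃ F N (theta13OfThm1CCMWZ F N j γ ε₀ ε₂₉ B₃ B₃' a₀ a₁ Efl logz) p) s.Ω s.Λ j' (Sect2.domSites (F.P p.K) (theta13OfThm1CCMWZ F N j γ ε₀ ε₂₉ B₃ B₃' a₀ a₁ Efl logz).τ9.M j' X) = true →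
        Sect2.ofBackgroundC (settingOfRecord₁₃ F N (theta13OfThm1CCMWZ F N j γ ε₀ ε₂₉ B₃ B₃' a₀ a₁ Efl logz) p).ι (UbgOfRecord₁₃CoP F N (theta13OfThm1CCMWZ F N j γ ε₀ ε₂₉ B₃ B₃' a₀ a₁ Efl logz) p n s W) ∈
          Sect2.spaceMS (settingOfRecord₁₃ F N (theta13OfThm1CCMWZ F N j γ ε₀ ε₂₉ B₃ B₃' a₀ a₁ Efl logz) p) ((theta13OfThm1CCMWZ F N j γ ε₀ ε₂₉ B₃ B₃' a₀ a₁ Efl logz).Rz p.K) (theta13OfThm1CCMWZ F N j γ ε₀ ε₂₉ B₃ B₃' a₀ a₁ Efl logz).τ9.M j' (Sect2.domSites (F.P p.K) (theta13OfThm1CCMWZ F N j γ ε₀ ε₂₉ B₃ B₃' a₀ a₁ Efl logz).τ9.M j' X) s.Ω) :=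
  bgSepCoPAt_theta13OfThm1CCMW_of_thm1RegSepCoP7MG_of_thm1GaugeG_of_hcomp_allTorus hγ0 hγ hε hε' hB hB' ha₀ ha₁ hc hc₀ h15 h15G hcomp hcompRev

end RowZ

/-! ## §2  ★★ The NAMED parameter: `Provisos₁₃SepCoP` at the z-witness, the ⁵ conjuncts, and the cured ∕ history-blind ⁷ parameter with the letters read back -/

section NamedZ

variable {F : T4Family} {N : ℕ} [NeZero N] {j c c₀ : ℕ} {γ ε₀ ε₂₉ B₃ B₃' a₀ a₁ : ℝ} {Efl logz : B12.RunParams → ℕ → ℝ}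

/-- **★★ `Provisos₁₃SepCoP` AT THE NAMED z-WITNESS `θ₁₅ᶜᶜᴹᵂᶻ(j; γ; …; Efl, logz)`** from the guarded antecedents at the concrete guard and (hcomp) ∧ (hcompRev): §1 into K0a's θ-generic
`Stage13Params.provisos₁₃SepCoP_liveRepin₁₃_of_bgSepCoP` at Z2's `theta13OfNumericsZ` (residuals of record; pins `τ9.M = L^j`, `M₁ ∣ M`).  CONDITIONAL; the `bg` content is the antecedents'.
[cite: Balaban1988Convergent, Thm 1 p.262, (2.18) p.257, (2.28) p.259, (3.16) p.268, (3.22) p.269; Balaban1989LargeFieldI, (0.3)–(0.4) p.176; Balaban1985Variational, Thm 1 (8)–(9) p.279, p.304 lines 1–2] -/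
theorem provisos₁₃SepCoP_theta13OfThm1CCMWZ_of_thm1RegSepCoP7MG_of_thm1GaugeG_of_hcomp (hγ0 : 0 < γ) (hγ : γ ≤ 1 / 2) (hε : 0 < ε₀) (hε' : 0 < ε₂₉) (hB : 0 ≤ B₃) (hB' : 0 ≤ B₃')
    (ha₀ : 0 < a₀) (ha₁ : 0 < a₁) (hc : c ≤ F.L ^ j) (hc₀ : c₀ ≤ j + 1)
    (h15 : VariationalThm1RegSepCoP7MG F N (fun ν _M _g K k _s => c ≤ ν.M₁ ∧ k + c₀ ≤ F.m + K) B₃ a₀ a₁)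
    (h15G : VariationalThm1GaugeRegSepCoP7MG F N (F.L ^ j) (fun ν _M _g K k _s => c ≤ ν.M₁ ∧ k + c₀ ≤ F.m + K) B₃ B₃' a₀ a₁)
    (hcomp : ∀ (p : B12.RunParams) (n : ℕ), n ≤ p.K → Step.InInterval (theta13OfThm1CCMWZ F N j γ ε₀ ε₂₉ B₃ B₃' a₀ a₁ Efl logz).γ n (gOfRecord₁₃ F N (theta13OfThm1CCMWZ F N j γ ε₀ ε₂₉ B₃ B₃' a₀ a₁ Efl logz) p) → ∀ m, m < n →
      (theta13OfThm1CCMWZ F N j γ ε₀ ε₂₉ B₃ B₃' a₀ a₁ Efl logz).s2.cR * epsOfRecord (theta13OfThm1CCMWZ F N j γ ε₀ ε₂₉ B₃ B₃' a₀ a₁ Efl logz).ν (gOfRecord₁₃ F N (theta13OfThm1CCMWZ F N j γ ε₀ ε₂₉ B₃ B₃' a₀ a₁ Efl logz) p) m ≤ 2 * ((theta13OfThm1CCMWZ F N j γ ε₀ ε₂₉ B₃ B₃' a₀ a₁ Efl logz).s2.cR * epsOfRecord (theta13OfThm1CCMWZ F N j γ ε₀ ε₂₉ B₃ B₃' a₀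 a₁ Efl logz).ν (gOfRecord₁₃ F N (theta13OfThm1CCMWZ F N j γ ε₀ ε₂₉ B₃ B₃' a₀ a₁ Efl logz) p) (m + 1)))
    (hcompRev : ∀ (p : B12.RunParams) (n : ℕ), n ≤ p.K → Step.InInterval (theta13OfThm1CCMWZ F N j γ ε₀ ε₂₉ B₃ B₃' a₀ a₁ Efl logz).γ n (gOfRecord₁₃ F N (theta13OfThm1CCMWZ F N j γ ε₀ ε₂₉ B₃ B₃' a₀ a₁ Efl logz) p) → ∀ m, m < n →
      (theta13OfThm1CCMWZ F N j γ ε₀ ε₂₉ B₃ B₃' a₀ a₁ Efl logz).s2.cR * epsOfRecord (theta13OfThm1CCMWZ F N j γ ε₀ ε₂₉ B₃ B₃' a₀ a₁ Efl logz).ν (gOfRecord₁₃ F N (theta13OfThm1CCMWZ F N j γ ε₀ ε₂₉ B₃ B₃' a₀ a₁ Efl logz) p) (m + 1) ≤ 2 * ((theta13OfThm1CCMWZ F N j γ ε₀ ε₂₉ B₃ B₃' a₀ a₁ Efl logz).s2.cR * epsOfRecord (theta13OfThm1CCMWZ F N j γ ε₀ ε₂₉ B₃ B₃' a₀ a₁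 Efl logz).ν (gOfRecord₁₃ F N (theta13OfThm1CCMWZ F N j γ ε₀ ε₂₉ B₃ B₃' a₀ a₁ Efl logz) p) m)) :
    (theta13OfThm1CCMWZ F N j γ ε₀ ε₂₉ B₃ B₃' a₀ a₁ Efl logz).Provisos₁₃SepCoP F N :=
  (theta13OfNumericsZ F N (stage12NumericsOfThm1CCMW F.L j γ ε₀ B₃ B₃' a₀ a₁) ε₂₉ _ _ _ Efl logz).provisos₁₃SepCoP_liveRepin₁₃_of_bgSepCoP
    (hasResidualsOfRecord_theta13OfNumericsZ F N _ ε₂₉ Efl logz) ⟨j, rfl⟩ (dvd_refl _)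
    (bgSepCoPAt_theta13OfThm1CCMWZ_of_thm1RegSepCoP7MG_of_thm1GaugeG_of_hcomp_allTorus hγ0 hγ hε hε' hB hB' ha₀ ha₁ hc hc₀ h15 h15G hcomp hcompRev)

/-- **★★ THE ⁵ K0 CONJUNCTS AT THE NAMED z-WITNESS** (`Provisos₁₃SepCoP` §2 · `ZtUnity` · `SlotsNondegenerate₁₃` hypothesis-free · `Admissible` — Z2's rows at `θ₁₅ᶜᶜᴹᵂᶻ`).  CONDITIONAL.
[cite: Balaban1988Convergent, Thm 1 p.262, (2.7) p.255, (2.28) p.259, (3.16)–(3.22) pp.268–269; Balaban1989LargeFieldI, (0.3)–(0.4) p.176] -/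
theorem k0SepCoPAt_theta13OfThm1CCMWZ_of_thm1RegSepCoP7MG_of_thm1GaugeG_of_hcomp (hγ0 : 0 < γ) (hγ : γ ≤ 1 / 2) (hε : 0 < ε₀) (hε' : 0 < ε₂₉) (hB : 0 ≤ B₃) (hB' : 0 ≤ B₃')
    (ha₀ : 0 < a₀) (ha₁ : 0 < a₁) (hc : c ≤ F.L ^ j) (hc₀ : c₀ ≤ j + 1)
    (h15 : VariationalThm1RegSepCoP7MG F N (fun ν _M _g K k _s => c ≤ ν.M₁ ∧ k + c₀ ≤ F.m + K) B₃ a₀ a₁)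
    (h15G : VariationalThm1GaugeRegSepCoP7MG F N (F.L ^ j) (fun ν _M _g K k _s => c ≤ ν.M₁ ∧ k + c₀ ≤ F.m + K) B₃ B₃' a₀ a₁)
    (hcomp : ∀ (p : B12.RunParams) (n : ℕ), n ≤ p.K → Step.InInterval (theta13OfThm1CCMWZ F N j γ ε₀ ε₂₉ B₃ B₃' a₀ a₁ Efl logz).γ n (gOfRecord₁₃ F N (theta13OfThm1CCMWZ F N j γ ε₀ ε₂₉ B₃ B₃' a₀ a₁ Efl logz) p) → ∀ m, m < n →
      (theta13OfThm1CCMWZ F N j γ ε₀ ε₂₉ B₃ B₃' a₀ a₁ Efl logz).s2.cR * epsOfRecord (theta13OfThm1CCMWZ F N j γ ε₀ ε₂₉ B₃ B₃' a₀ a₁ Efl logz).ν (gOfRecord₁₃ F N (theta13OfThm1CCMWZ F N j γ ε₀ ε₂₉ B₃ B₃' a₀ a₁ Efl logz) p) m ≤ 2 * ((theta13OfThm1CCMWZ F N j γ ε₀ ε₂₉ B₃ B₃' a₀ a₁ Efl logz).s2.cR * epsOfRecord (theta13OfThm1CCMWZ F N j γ ε₀ ε₂₉ B₃ B₃' a₀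 a₁ Efl logz).ν (gOfRecord₁₃ F N (theta13OfThm1CCMWZ F N j γ ε₀ ε₂₉ B₃ B₃' a₀ a₁ Efl logz) p) (m + 1)))
    (hcompRev : ∀ (p : B12.RunParams) (n : ℕ), n ≤ p.K → Step.InInterval (theta13OfThm1CCMWZ F N j γ ε₀ ε₂₉ B₃ B₃' a₀ a₁ Efl logz).γ n (gOfRecord₁₃ F N (theta13OfThm1CCMWZ F N j γ ε₀ ε₂₉ B₃ B₃' a₀ a₁ Efl logz) p) → ∀ m, m < n →
      (theta13OfThm1CCMWZ F N j γ ε₀ ε₂₉ B₃ B₃' a₀ a₁ Efl logz).s2.cR * epsOfRecord (theta13OfThm1CCMWZ F N j γ ε₀ ε₂₉ B₃ B₃' a₀ a₁ Efl logz).ν (gOfRecord₁₃ F N (theta13OfThm1CCMWZ F N j γ ε₀ ε₂₉ B₃ B₃' a₀ a₁ Efl logz) p) (m + 1) ≤ 2 * ((theta13OfThm1CCMWZ F N j γ ε₀ ε₂₉ B₃ B₃' a₀ a₁ Efl logz).s2.cR * epsOfRecord (theta13OfThm1CCMWZ F N j γ ε₀ ε₂₉ B₃ B₃' a₀ a₁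 Efl logz).ν (gOfRecord₁₃ F N (theta13OfThm1CCMWZ F N j γ ε₀ ε₂₉ B₃ B₃' a₀ a₁ Efl logz) p) m)) :
    (theta13OfThm1CCMWZ F N j γ ε₀ ε₂₉ B₃ B₃' a₀ a₁ Efl logz).Provisos₁₃SepCoP F N ∧ ((theta13OfThm1CCMWZ F N j γ ε₀ ε₂₉ B₃ B₃' a₀ a₁ Efl logz).ZtUnity F N ∧ (theta13OfThm1CCMWZ F N j γ ε₀ ε₂₉ B₃ B₃' a₀ a₁ Efl logz).SlotsNondegenerate₁₃ F N) ∧ (theta13OfThm1CCMWZ F N j γ ε₀ ε₂₉ B₃ B₃' a₀ a₁ Efl logz).Admissible F N :=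
  ⟨provisos₁₃SepCoP_theta13OfThm1CCMWZ_of_thm1RegSepCoP7MG_of_thm1GaugeG_of_hcomp hγ0 hγ hε hε' hB hB' ha₀ ha₁ hc hc₀ h15 h15G hcomp hcompRev,
    ⟨ztUnity_theta13OfThm1CCMWZ F N j γ ε₀ ε₂₉ B₃ B₃' a₀ a₁ Efl logz, slotsNondegenerate₁₃_theta13OfThm1CCMWZ F N j γ ε₀ ε₂₉ B₃ B₃' a₀ a₁ Efl logz⟩,
    admissible_theta13OfThm1CCMWZ_of_le_half F N Efl logz hγ0 hγ hε hε' hB hB' ha₀ ha₁⟩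

/-- **★★ THE ⁷ K0 CONJUNCTS AT THE NAMED CURED ∕ HISTORY-BLIND LIFT OF THE z-WITNESS** — `θ := Stage13HParams.ofHistoryBlind (Stage13RParams.ofCured θ₁₅ᶜᶜᴹᵂᶻ(…; Efl, logz))`, whose
`Efl`∕`logz` ARE the letters (§0): node00-def-R's `Provisos₁₃SepCoP.ofCured` ∕ `zrUnity_ofCured` and def-T's `Provisos₁₃SepCoPR.ofHistoryBlind` ∕ `ZrUnity.ofHistoryBlind` over §2.  CONDITIONAL.
[cite: Balaban1988Convergent, Thm 1 p.262, (1.11) p.248, (3.16)–(3.23) pp.268–270; Balaban1989LargeFieldI, (0.2)–(0.4) p.176] -/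
theorem k0SepCoPHAt_ofHistoryBlind_ofCured_theta13OfThm1CCMWZ (hγ0 : 0 < γ) (hγ : γ ≤ 1 / 2) (hε : 0 < ε₀) (hε' : 0 < ε₂₉) (hB : 0 ≤ B₃) (hB' : 0 ≤ B₃')
    (ha₀ : 0 < a₀) (ha₁ : 0 < a₁) (hc : c ≤ F.L ^ j) (hc₀ : c₀ ≤ j + 1)
    (h15 : VariationalThm1RegSepCoP7MG F N (fun ν _M _g K k _s => c ≤ ν.M₁ ∧ k + c₀ ≤ F.m + K) B₃ a₀ a₁)
    (h15G : VariationalThm1GaugeRegSepCoP7MG F N (F.L ^ j) (fun ν _M _g K k _s => c ≤ ν.M₁ ∧ k + c₀ ≤ F.m + K) B₃ B₃' a₀ a₁)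
    (hcomp : ∀ (p : B12.RunParams) (n : ℕ), n ≤ p.K → Step.InInterval (theta13OfThm1CCMWZ F N j γ ε₀ ε₂₉ B₃ B₃' a₀ a₁ Efl logz).γ n (gOfRecord₁₃ F N (theta13OfThm1CCMWZ F N j γ ε₀ ε₂₉ B₃ B₃' a₀ a₁ Efl logz) p) → ∀ m, m < n →
      (theta13OfThm1CCMWZ F N j γ ε₀ ε₂₉ B₃ B₃' a₀ a₁ Efl logz).s2.cR * epsOfRecord (theta13OfThm1CCMWZ F N j γ ε₀ ε₂₉ B₃ B₃' a₀ a₁ Efl logz).ν (gOfRecord₁₃ F N (theta13OfThm1CCMWZ F N j γ ε₀ ε₂₉ B₃ B₃' a₀ a₁ Efl logz) p) m ≤ 2 * ((theta13OfThm1CCMWZ F N j γ ε₀ ε₂₉ B₃ B₃' a₀ a₁ Efl logz).s2.cR * epsOfRecord (theta13OfThm1CCMWZ F N j γ ε₀ ε₂₉ B₃ B₃' a₀ a₁ Efl logz).ν (gOfRecord₁₃ F N (theta13OfThm1CCMWZ F N j γ ε₀ ε₂₉ B₃ B₃' a₀ a₁ Efl logz) p) (m + 1)))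
    (hcompRev : ∀ (p : B12.RunParams) (n : ℕ), n ≤ p.K → Step.InInterval (theta13OfThm1CCMWZ F N j γ ε₀ ε₂₉ B₃ B₃' a₀ a₁ Efl logz).γ n (gOfRecord₁₃ F N (theta13OfThm1CCMWZ F N j γ ε₀ ε₂₉ B₃ B₃' a₀ a₁ Efl logz) p) → ∀ m, m < n →
      (theta13OfThm1CCMWZ F N j γ ε₀ ε₂₉ B₃ B₃' a₀ a₁ Efl logz).s2.cR * epsOfRecord (theta13OfThm1CCMWZ F N j γ ε₀ ε₂₉ B₃ B₃' a₀ a₁ Efl logz).ν (gOfRecord₁₃ F N (theta13OfThm1CCMWZ F N j γ ε₀ ε₂₉ B₃ B₃' a₀ a₁ Efl logz) p) (m + 1) ≤ 2 * ((theta13OfThm1CCMWZ F N j γ ε₀ ε₂₉ B₃ B₃' a₀ a₁ Efl logz).s2.cR * epsOfRecord (theta13OfThm1CCMWZ F N j γ ε₀ ε₂₉ B₃ B₃' a₀ a₁ Efl logz).ν (gOfRecord₁₃ F N (theta13OfThm1CCMWZ F N j γ ε₀ ε₂₉ B₃ B₃' a₀ a₁ Efl logz) p) m)) :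
    (Stage13HParams.ofHistoryBlind F N (Stage13RParams.ofCured F N (theta13OfThm1CCMWZ F N j γ ε₀ ε₂₉ B₃ B₃' a₀ a₁ Efl logz))).Provisos₁₃SepCoPH F N ∧
      ((Stage13HParams.ofHistoryBlind F N (Stage13RParams.ofCured F N (theta13OfThm1CCMWZ F N j γ ε₀ ε₂₉ B₃ B₃' a₀ a₁ Efl logz))).ZhUnity F N ∧
        (Stage13HParams.ofHistoryBlind F N (Stage13RParams.ofCured F N (theta13OfThm1CCMWZ F N j γ ε₀ ε₂₉ B₃ B₃' a₀ a₁ Efl logz))).SlotsNondegenerate₁₃ F N) ∧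
      (Stage13HParams.ofHistoryBlind F N (Stage13RParams.ofCured F N (theta13OfThm1CCMWZ F N j γ ε₀ ε₂₉ B₃ B₃' a₀ a₁ Efl logz))).Admissible F N := by
  obtain ⟨hP, ⟨_, hS⟩, hA⟩ := k0SepCoPAt_theta13OfThm1CCMWZ_of_thm1RegSepCoP7MG_of_thm1GaugeG_of_hcomp hγ0 hγ hε hε' hB hB' ha₀ ha₁ hc hc₀ h15 h15G hcomp hcompRev
  exact ⟨hP.ofCured.ofHistoryBlind, ⟨(Stage13RParams.zrUnity_ofCured _).ofHistoryBlind, hS⟩, hA⟩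

end NamedZ

/-! ## §3  ★★★ From the V20-G stub antecedents (cube letter `(j, c, c₀)`, the guarded (9)-STEP fact, ONE abs β-box of `θ₁₅ᶜᶜᴹ(j)`) and from the three stub texts: the NAMED ⁷ parameter
at the z-witness FOR EVERY `(Efl, logz)` -/

section FromStubsZ

/-- **★★★ FOR EVERY `(Efl, logz)`: THE NAMED ⁷ K0 PARAMETER AT THE z-WITNESS FROM THE GUARDED (8), THE GUARDED (9)-STEP FACT AT `(L^j, guard)` AND ONE ABS β-BOX OF `θ₁₅ᶜᶜᴹ(j)`** —
PART 1 §1 `clausesH_of_absBox` (token-free; the box at `θ₁₅ᶜᶜᴹ(j)` serves every z-member since `β₁₃` is letter-blind, §0) gives the window `γ` and (hcomp) ∧ (hcompRev); the gauge sentence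
from the step fact by dag-n07-e's `variationalThm1GaugeRegSepCoP7MG_of_gauge9TopStepG`; then §2.  OUTPUT: `∃ γ ε₀ ε₂₉` (the window and thresholds of the box) such that the NAMED
`θ := ofHistoryBlind (ofCured θ₁₅ᶜᶜᴹᵂᶻ(j; γ; ε₀, ε₂₉; B₃, B₉, a₀, a₁; Efl, logz))` carries K0⁷'s four conjuncts — its `Efl`∕`logz` are the caller's letters (§0).  CONDITIONAL.
[cite: Balaban1985Variational, Thm 1 (8)–(9) p.279, (144)–(152) pp.300–301, Prop. 8 p.304, p.304 lines 1–2; Balaban1988Convergent, Thm 1 p.262, (1.15) p.249, (2.21) p.258; Balaban1987RG1, Thm 1 p.259, (0.1) p.251, §1 p.264; Balaban1989LargeFieldI, (0.2)–(0.4) p.176] -/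
theorem exists_window_k0SepCoPHAt_zWitness_of_thm1CoP7MG_of_gauge9G_of_absBox (F : T4Family) (Efl logz : B12.RunParams → ℕ → ℝ) {j c c₀ : ℕ}
    (hc : c ≤ F.L ^ j) (hc₀ : c₀ ≤ j + 1) {B₃ B₉ a₀ a₁ : ℝ} (hB₃ : 0 ≤ B₃) (hB₉ : 0 ≤ B₉) (ha₀ : 0 < a₀) (ha₁ : 0 < a₁)
    (h15 : VariationalThm1RegSepCoP7MG F 2 (fun ν _M _g K k _s => c ≤ ν.M₁ ∧ k + c₀ ≤ F.m + K) B₃ a₀ a₁)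
    (h9 : Gauge9RegSepTopStepG F 2 (fun ν K Ω => suppDomOfRecord F ν K Ω) (F.L ^ j) (fun ν _M _g K k _s => c ≤ ν.M₁ ∧ k + c₀ ≤ F.m + K) B₃ B₉ a₀ a₁)
    (h3A : ∃ γ₀ ε₀ ε₂₉ β' : ℝ, 0 < γ₀ ∧ 0 < ε₀ ∧ 0 < ε₂₉ ∧
        BetaLowerH (-β') γ₀ (betaOfRecord₁₃ F 2 (theta13OfThm1CCM F 2 j ε₀ ε₂₉ B₃ B₉ a₀ a₁)) ∧
        BetaUpperH β' γ₀ (betaOfRecord₁₃ F 2 (theta13OfThm1CCM F 2 j ε₀ ε₂₉ B₃ B₉ a₀ a₁))) :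
    ∃ γ ε₀ ε₂₉ : ℝ, 0 < γ ∧ γ ≤ 1 / 2 ∧ 0 < ε₀ ∧ 0 < ε₂₉ ∧
      (Stage13HParams.ofHistoryBlind F 2 (Stage13RParams.ofCured F 2 (theta13OfThm1CCMWZ F 2 j γ ε₀ ε₂₉ B₃ B₉ a₀ a₁ Efl logz))).Provisos₁₃SepCoPH F 2 ∧
      ((Stage13HParams.ofHistoryBlind F 2 (Stage13RParams.ofCured F 2 (theta13OfThm1CCMWZ F 2 j γ ε₀ ε₂₉ B₃ B₉ a₀ a₁ Efl logz))).ZhUnity F 2 ∧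
        (Stage13HParams.ofHistoryBlind F 2 (Stage13RParams.ofCured F 2 (theta13OfThm1CCMWZ F 2 j γ ε₀ ε₂₉ B₃ B₉ a₀ a₁ Efl logz))).SlotsNondegenerate₁₃ F 2) ∧
      (Stage13HParams.ofHistoryBlind F 2 (Stage13RParams.ofCured F 2 (theta13OfThm1CCMWZ F 2 j γ ε₀ ε₂₉ B₃ B₉ a₀ a₁ Efl logz))).Admissible F 2 := by
  obtain ⟨γ, ε₀, ε₂₉, hγ0, hγ, hε, hε', hcomp, hcompRev⟩ := clausesH_of_absBox F j hB₃ hB₉ ha₀.le ha₁.le h3A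
  exact ⟨γ, ε₀, ε₂₉, hγ0, hγ, hε, hε',
    k0SepCoPHAt_ofHistoryBlind_ofCured_theta13OfThm1CCMWZ hγ0 hγ hε hε' hB₃ hB₉ ha₀ ha₁ hc hc₀ h15 (variationalThm1GaugeRegSepCoP7MG_of_gauge9TopStepG h9)
      hcomp hcompRev⟩

/-- **★★★ FOR EVERY `(Efl, logz)`: A NAMED ⁷ K0 PARAMETER IN THE z-FAMILY FROM THE THREE V20-G STUB TEXTS AT `F`** (stub 1-G, stub 2′, 3ᴬ′-G VERBATIM = `K0PrintCubeOfStepTokensGuarded`'s binders):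
stub 1-G ⇒ the guarded (8) (dag-n07-e 53), stub 2′ ⇒ the guarded (9)-step fact at `(L^j, guard(c′, c₀))`, `j := ρ₀ + 3 + c + c₀` (this seat's `gauge9SupplierG_of_prop6MemberP`), 3ᴬ′-G there ⇒
the box ⇒ the previous theorem.  OUTPUT: `∃ j γ ε₀ ε₂₉ B₃ B₉ a₀ a₁` such that `ofHistoryBlind (ofCured θ₁₅ᶜᶜᴹᵂᶻ(j; γ; ε₀, ε₂₉; B₃, B₉, a₀, a₁; Efl, logz))` carries K0⁷'s four conjuncts —
ONE θ, with the caller's fluctuation letters, serving K0⁷'s body; the K1⁹ prover instantiates its existential at it.  CONDITIONAL; K0⁷ ∕ K1⁹ NOT closed here; FLAG №9 not closed by this.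
[cite: Balaban1985Variational, Thm 1 (8)–(9) p.279, (144)–(152) pp.300–301, Prop. 8 p.304, p.304 lines 1–2; Balaban1985RegularSpaces, Prop. 6 p.99, p.98; Balaban1988Convergent, Thm 1 p.262, (1.15) p.249; Balaban1987RG1, Thm 1 p.259, (0.1) p.251, §1 p.264; Balaban1989LargeFieldI, (0.2)–(0.4) p.176] -/
theorem exists_named_k0SepCoPHAt_zWitness_of_stubs1G_2P_3A'G (F : T4Family) (Efl logz : B12.RunParams → ℕ → ℝ)
    (h1G : ∃ (c c₀ : ℕ) (B₃ a₀ a₁ : ℝ), 2 * (F.L : ℝ) ^ 2 ≤ B₃ ∧ 0 < a₀ ∧ 0 < a₁ ∧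
      Prop8RegSepTopStepG F 2 (fun ν K Ω => suppDomOfRecord F ν K Ω) (fun ν _M _g K k _s => c ≤ ν.M₁ ∧ k + c₀ ≤ F.m + K) B₃ a₀ a₁)
    (h2P : ∃ (ρ₀ : ℕ) (B₁ c₁ : ℝ), 1 ≤ ρ₀ ∧ 0 ≤ B₁ ∧ 0 < c₁ ∧
      (letI : CStarAlgebra (MatA 2) := {}; B8.Prop6Printed 4 (F.L : ℝ) B₁ c₁ (fun i : ZdIdx 4 F.L => zdCubP (MatA 2) F.L ρ₀ i)))
    (h3A'G : ∀ (j c c₀ : ℕ) (B₃ B₃' a₀ a₁ : ℝ), c ≤ F.L ^ j → c₀ ≤ j + 1 → 2 * (F.L : ℝ) ^ 2 ≤ B₃ → 0 < B₃' → 0 < a₀ → 0 < a₁ →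
      VariationalThm1RegSepCoP7MG F 2 (fun ν _M _g K k _s => c ≤ ν.M₁ ∧ k + c₀ ≤ F.m + K) B₃ a₀ a₁ →
      Gauge9RegSepTopStepG F 2 (fun ν K Ω => suppDomOfRecord F ν K Ω) (F.L ^ j) (fun ν _M _g K k _s => c ≤ ν.M₁ ∧ k + c₀ ≤ F.m + K) B₃ B₃' a₀ a₁ →
      ∃ γ₀ ε₀ ε₂₉ β' : ℝ, 0 < γ₀ ∧ 0 < ε₀ ∧ 0 < ε₂₉ ∧
        BetaLowerH (-β') γ₀ (betaOfRecord₁₃ F 2 (theta13OfThm1CCM F 2 j ε₀ ε₂₉ B₃ B₃' a₀ a₁)) ∧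
        BetaUpperH β' γ₀ (betaOfRecord₁₃ F 2 (theta13OfThm1CCM F 2 j ε₀ ε₂₉ B₃ B₃' a₀ a₁))) :
    ∃ (j : ℕ) (γ ε₀ ε₂₉ B₃ B₉ a₀ a₁ : ℝ),
      (Stage13HParams.ofHistoryBlind F 2 (Stage13RParams.ofCured F 2 (theta13OfThm1CCMWZ F 2 j γ ε₀ ε₂₉ B₃ B₉ a₀ a₁ Efl logz))).Provisos₁₃SepCoPH F 2 ∧
      ((Stage13HParams.ofHistoryBlind F 2 (Stage13RParams.ofCured F 2 (theta13OfThm1CCMWZ F 2 j γ ε₀ ε₂₉ B₃ B₉ a₀ a₁ Efl logz))).ZhUnity F 2 ∧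
        (Stage13HParams.ofHistoryBlind F 2 (Stage13RParams.ofCured F 2 (theta13OfThm1CCMWZ F 2 j γ ε₀ ε₂₉ B₃ B₉ a₀ a₁ Efl logz))).SlotsNondegenerate₁₃ F 2) ∧
      (Stage13HParams.ofHistoryBlind F 2 (Stage13RParams.ofCured F 2 (theta13OfThm1CCMWZ F 2 j γ ε₀ ε₂₉ B₃ B₉ a₀ a₁ Efl logz))).Admissible F 2 := by
  obtain ⟨c, c₀, B₃, a₀, a₁, hB₃, ha₀, ha₁, h8⟩ := h1G
  have hL : (0 : ℝ) < (F.L : ℝ) := by exact_mod_cast lt_trans Nat.zero_lt_one F.hL.2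
  have hBpos : (0 : ℝ) < B₃ := lt_of_lt_of_le (mul_pos two_pos (pow_pos hL 2)) hB₃
  obtain ⟨j, c', B₉, a₁', hcc', hc', hc₀, hB₉, ha₁', ha₁'le, h9⟩ := gauge9SupplierG_of_prop6MemberP F h2P c c₀ B₃ a₀ a₁ hB₃ ha₀ ha₁ h8
  have h15 : VariationalThm1RegSepCoP7MG F 2 (fun ν _M _g K k _s => c' ≤ ν.M₁ ∧ k + c₀ ≤ F.m + K) B₃ a₀ a₁' :=
    (variationalThm1RegSepCoP7MG_of_prop8TopStepG hBpos (h8.of_le le_rfl ha₁'le)).of_imp fun _ _ _ _ _ _ h => ⟨hcc'.trans h.1, h.2⟩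
  obtain ⟨γ, ε₀, ε₂₉, -, -, -, -, H⟩ := exists_window_k0SepCoPHAt_zWitness_of_thm1CoP7MG_of_gauge9G_of_absBox F Efl logz hc' hc₀ hBpos.le hB₉.le ha₀ ha₁' h15 h9
    (h3A'G j c' c₀ B₃ B₉ a₀ a₁' hc' hc₀ hB₃ hB₉ ha₀ ha₁' h15 h9)
  exact ⟨j, γ, ε₀, ε₂₉, B₃, B₉, a₀, a₁', H⟩

end FromStubsZ

end Summit.QuantumFields.YangMills.Theorems.K0NamedZWitnessOfStepTokensGuarded

end
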